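/-
Copyright (c) 2026 the pub-hodgecm-mathlib formalisation cell (harness21).  Prover seat hodgecm-mathlib-K2Liu-p10 (g0), Track B «K2-LIT»,
#184♮ = hLiu418 = `stmt-HodgeConjecture-24832`; LEAD F0P6-plan (g12) RE-DEAL 2026-09-04T06:46:52Z ∕ 06:48:17Z «Hol-1», SIGS-RoadI-v3 §Hol
row H1-A (K2E5-plan (g5)).  THEOREMS ONLY (no `def`, no `instance`, no named-fact hypothesis, no `sorry`).
-/
import Literature.NumberTheory.ModularForms.SiegelUpperHalfSpaceAction
import Literature.NumberTheory.Automorphic.UnitaryGroupAutomorphicRep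
import Literature.AlgebraicGeometry.ShimuraVarieties.KudlaRapoport2013.Sec11Sec12MainTheorem
import HarnessLib

/-!
# Crux `HLiu418`, Road I, organ Hol-1 (H1-A): the hermitian tube `ℌ_n` of `U(n,n)` — block relations, the key identity,
# invertibility of `CZ + D`, `Im (g·Z) = (CZ+D)⁻ᴴ (Im Z) (CZ+D)⁻¹`, the cocycle, and the Siegel-parabolic formulas

Cell `hodgecm-mathlib`, crux item hLiu418 = `stmt-HodgeConjecture-24832` (helper lane, count-neutral).

DICTIONARY FROZEN BY LEAD (06:48:17Z), realised WITHOUT any new definition (census 06:48Z–07:05Z: every object is already a tree ∕ Mathlib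
term, so the planned DEFS leaf `K2LiuHermitianTubeDefs` is EMPTY and is not filed):
* the tube `ℌ_n = {Z ∈ M_n(ℂ) | (2i)⁻¹(Z − Zᴴ) ≻ 0}` **is** ★ `Literature.AlgebraicGeometry.ShimuraVarieties.KudlaRapoport2013.
  Sec11Sec12MainTheorem.hermUpperHalfSpace n` ([KudlaRapoport2013, §7 p. 31] `D_n`), membership is DEFINITIONALLY
  `((2 * Complex.I)⁻¹ • (Z - Zᴴ)).PosDef`; all statements below are made for a general finite index type `l` with that predicate
  written out, and specialised to `hermUpperHalfSpace n` (`l = Fin n`) at the end of each section;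
* `moebDen g Z = CZ + D`, `moeb g Z = (AZ + B)(CZ + D)⁻¹` **are** ★ `Literature.NumberTheory.ModularForms.SiegelUpperHalfSpace.denom ∕ num ∕
  moeb` (generic complex block matrices, with ★ `moeb_mul`, `denom_mul_eq`, `moeb_one`); the automorphy factor is `(denom g Z).det`;
* the form: `tubeForm = (0 −i·1; i·1 0) = Complex.I • Matrix.J l ℂ` (Mathlib `Matrix.J l R = fromBlocks 0 (−1) 1 0`), and
  `U(n,n)(ℝ) = ★ unitaryGroupOfForm (starRingEnd ℂ) (Complex.I • Matrix.J l ℂ)`; since the unit `i` cancels, the working hypothesis of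
  this file is the matrix identity `Pᴴ * Matrix.J l ℂ * P = Matrix.J l ℂ` (`mem_unitaryGroupOfForm_smul_J_iff`).

CONTENTS.  §1 block relations `AᴴC = CᴴA`, `BᴴD = DᴴB`, `AᴴD − CᴴB = 1`, `DᴴA − BᴴC = 1` (and the converse, used to put
translations, Levi elements and the inversion in the group); §2 the key identity `(WCᴴ + Dᴴ)(AZ + B) − (WAᴴ + Bᴴ)(CZ + D) = Z − W`,
hence `(CZ+D)ᴴ(AZ+B) − (AZ+B)ᴴ(CZ+D) = Z − Zᴴ`; §3 on the tube `CZ + D` is invertible and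
`(CZ+D)ᴴ · Im(g·Z) · (CZ+D) = Im Z`, so `g·Z ∈ ℌ` (`moeb_mem_hermUpperHalfSpace`); §4 the cocycle
`det(denom (gh) Z) = det(denom g (h·Z)) · det(denom h Z)` (integer powers included) and the action law on the tube; §5 the Siegel
parabolic `{C = 0}` acts affinely, translations `u(b) = (1 b; 0 1)` (`b` hermitian) by `Z ↦ Z + b` with trivial automorphy factor, Levi
elements `m(a) = (a 0; 0 a⁻ᴴ)` by `Z ↦ a Z aᴴ`, the inversion `J` by `Z ↦ −Z⁻¹` with factor `det Z`; the base point `i·1 ∈ ℌ` and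
`u(X) m(R) · i1 = X + i R²`.
Sources: [Shimura1997, §§5–6 (unitary tube domains, Case UT)],
[KudlaRapoport2013, §7]; the proofs transpose the tree's symplectic file ★ `SiegelUpperHalfSpaceAction` [Lange2023AbelianVarietiesComplex, §3.1.3] from `ᵀ` to `ᴴ`.
HONEST LABEL.  Helper lemmas, count-neutral; `HC_CM` is proved only modulo the 7 printed citations (2 remaining named inputs:
hLiu418 = `stmt-HodgeConjecture-24832`, h413 = `stmt-HodgeConjecture-24833`) until rung 0 closes.
-/

set_option autoImplicit false
set_option linter.dupNamespace false -- the mandated namespace repeats `HodgeConjecture.HodgeConjecture`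

namespace Summit.HodgeConjecture.HodgeConjecture.Cruxes.HLiu418.K2LiuHermitianTubeCocycle

open Matrix Complex
open scoped MatrixGroups ComplexOrder
open Literature.NumberTheory.ModularForms.SiegelUpperHalfSpace (num denom moeb num_def denom_def moeb_def
  num_fromBlocks denom_fromBlocks moeb_mul denom_mul_eq num_mul_eq moeb_mul_denom moeb_one)
open Literature.NumberTheory.Automorphic (unitaryGroupOfForm mem_unitaryGroupOfForm_iff)
open Literature.AlgebraicGeometry.ShimuraVarieties.KudlaRapoport2013.Sec11Sec12MainTheorem (hermUpperHalfSpace)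

variable {l : Type*} [Fintype l] [DecidableEq l]

/-! ## 1. Block relations of `U(J)`, `J = (0 −1; 1 0)` -/

/-- `(A B; C D)ᴴ J (A B; C D) = (CᴴA − AᴴC, CᴴB − AᴴD; DᴴA − BᴴC, DᴴB − BᴴD)`. [cite: Shimura1997, §5.1] -/
theorem fromBlocks_conjTranspose_mul_J_mul (A B C D : Matrix l l ℂ) :
    (fromBlocks A B C D)ᴴ * Matrix.J l ℂ * fromBlocks A B C D =
      fromBlocks (Cᴴ * A - Aᴴ * C) (Cᴴ * B - Aᴴ * D) (Dᴴ * A - Bᴴ * C) (Dᴴ * B - Bᴴ * D) := by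
  rw [fromBlocks_conjTranspose, Matrix.J, fromBlocks_multiply, fromBlocks_multiply]
  simp only [Matrix.mul_zero, Matrix.mul_one, Matrix.mul_neg, zero_add, add_zero, Matrix.neg_mul,
    ← sub_eq_add_neg]

/-- **`(A B; C D) ∈ U(J)` iff `AᴴC = CᴴA`, `BᴴD = DᴴB`, `AᴴD − CᴴB = 1`, `DᴴA − BᴴC = 1`.**
[cite: Shimura1997, §5.1] -/
theorem fromBlocks_conjTranspose_mul_J_mul_eq_iff (A B C D : Matrix l l ℂ) :
    (fromBlocks A B C D)ᴴ * Matrix.J l ℂ * fromBlocks A B C D = Matrix.J l ℂ ↔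
      Aᴴ * C = Cᴴ * A ∧ Bᴴ * D = Dᴴ * B ∧ Aᴴ * D - Cᴴ * B = 1 ∧ Dᴴ * A - Bᴴ * C = 1 := by
  rw [fromBlocks_conjTranspose_mul_J_mul, Matrix.J, fromBlocks_inj]
  constructor
  · rintro ⟨h1, h2, h3, h4⟩
    refine ⟨(sub_eq_zero.1 h1).symm, (sub_eq_zero.1 h4).symm, ?_, h3⟩
    rw [← neg_sub, neg_eq_iff_eq_neg, neg_neg] at h2
    exact h2
  · rintro ⟨h1, h2, h3, h4⟩
    refine ⟨sub_eq_zero.2 h1.symm, ?_, h4, sub_eq_zero.2 h2.symm⟩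
    rw [← neg_sub, h3]

/-- The block relations of `P ∈ U(J)`: `AᴴC = CᴴA`, `BᴴD = DᴴB`, `AᴴD − CᴴB = 1`, `DᴴA − BᴴC = 1`.
[cite: Shimura1997, §5.1] -/
theorem blocks_rel {P : Matrix (l ⊕ l) (l ⊕ l) ℂ} (hP : Pᴴ * Matrix.J l ℂ * P = Matrix.J l ℂ) :
    P.toBlocks₁₁ᴴ * P.toBlocks₂₁ = P.toBlocks₂₁ᴴ * P.toBlocks₁₁ ∧
      P.toBlocks₁₂ᴴ * P.toBlocks₂₂ = P.toBlocks₂₂ᴴ * P.toBlocks₁₂ ∧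
        P.toBlocks₁₁ᴴ * P.toBlocks₂₂ - P.toBlocks₂₁ᴴ * P.toBlocks₁₂ = 1 ∧
          P.toBlocks₂₂ᴴ * P.toBlocks₁₁ - P.toBlocks₁₂ᴴ * P.toBlocks₂₁ = 1 := by
  rw [← fromBlocks_toBlocks P] at hP
  exact (fromBlocks_conjTranspose_mul_J_mul_eq_iff _ _ _ _).1 hP

/-- `U(J)` is closed under products (matrix level). [cite: Shimura1997, §5.1] -/
theorem mul_mem_UJ {P Q : Matrix (l ⊕ l) (l ⊕ l) ℂ} (hP : Pᴴ * Matrix.J l ℂ * P = Matrix.J l ℂ)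
    (hQ : Qᴴ * Matrix.J l ℂ * Q = Matrix.J l ℂ) : (P * Q)ᴴ * Matrix.J l ℂ * (P * Q) = Matrix.J l ℂ := by
  rw [conjTranspose_mul]
  calc Qᴴ * Pᴴ * Matrix.J l ℂ * (P * Q) = Qᴴ * (Pᴴ * Matrix.J l ℂ * P) * Q := by
        simp only [Matrix.mul_assoc]
    _ = Matrix.J l ℂ := by rw [hP, hQ]

/-- **Bridge to the tree's unitary group**: for `g ∈ GL_{2n}(ℂ)`, `g ∈ U(⋆, i·J) = unitaryGroupOfForm (starRingEnd ℂ) (I • J)`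
(the form `(0 −i; i 0)`, hermitian of signature `(n,n)`) iff `gᴴ J g = J`. [cite: Shimura1997, §5.1] -/
theorem mem_unitaryGroupOfForm_smul_J_iff (g : GL (l ⊕ l) ℂ) :
    g ∈ unitaryGroupOfForm (starRingEnd ℂ) (I • Matrix.J l ℂ) ↔
      (g : Matrix (l ⊕ l) (l ⊕ l) ℂ)ᴴ * Matrix.J l ℂ * g = Matrix.J l ℂ := by
  rw [mem_unitaryGroupOfForm_iff]
  have hc : ((g : Matrix (l ⊕ l) (l ⊕ l) ℂ).map (starRingEnd ℂ))ᵀ = (g : Matrix (l ⊕ l) (l ⊕ l) ℂ)ᴴ := rfl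
  rw [hc, Matrix.mul_smul, Matrix.smul_mul]
  exact (smul_right_injective (Matrix (l ⊕ l) (l ⊕ l) ℂ) I_ne_zero).eq_iff

omit [Fintype l] in
/-- `i·J = (0 −i·1; i·1 0)` — the frozen normalisation of the tube form. [cite: Shimura1997, §5.1] -/
theorem smul_J_eq_fromBlocks :
    I • Matrix.J l ℂ = fromBlocks 0 (-(I • (1 : Matrix l l ℂ))) (I • 1) 0 := by
  rw [Matrix.J, fromBlocks_smul, smul_zero, smul_neg]

omit [Fintype l] in
/-- `i·J` is hermitian. [cite: Shimura1997, §5.1] -/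
theorem conjTranspose_smul_J : (I • Matrix.J l ℂ)ᴴ = I • Matrix.J l ℂ := by
  rw [smul_J_eq_fromBlocks, fromBlocks_conjTranspose]
  simp only [conjTranspose_zero, conjTranspose_neg, conjTranspose_smul, conjTranspose_one, star_def, conj_I,
    neg_smul, neg_neg]

/-! ## 2. The key identity -/

/-- **Key identity**: for `P = (A B; C D) ∈ U(J)` and ANY `W, Z`: `(WCᴴ + Dᴴ)(AZ + B) − (WAᴴ + Bᴴ)(CZ + D) = Z − W`.
[cite: Shimura1997, §6.2 (the unitary analogue of Lange2023 (3.6))] -/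
theorem key_identity {P : Matrix (l ⊕ l) (l ⊕ l) ℂ} (hP : Pᴴ * Matrix.J l ℂ * P = Matrix.J l ℂ)
    (W Z : Matrix l l ℂ) :
    (W * P.toBlocks₂₁ᴴ + P.toBlocks₂₂ᴴ) * num P Z - (W * P.toBlocks₁₁ᴴ + P.toBlocks₁₂ᴴ) * denom P Z =
      Z - W := by
  obtain ⟨h1, h2, h3, h4⟩ := blocks_rel hP
  set A := P.toBlocks₁₁
  set B := P.toBlocks₁₂
  set C := P.toBlocks₂₁
  set D := P.toBlocks₂₂
  calc (W * Cᴴ + Dᴴ) * num P Z - (W * Aᴴ + Bᴴ) * denom P Z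
      = W * (Cᴴ * A - Aᴴ * C) * Z + W * (Cᴴ * B - Aᴴ * D) + (Dᴴ * A - Bᴴ * C) * Z +
          (Dᴴ * B - Bᴴ * D) := by
        rw [num_def, denom_def]; noncomm_ring
    _ = Z - W := by
        rw [h1, h2, h4, sub_self, sub_self, Matrix.mul_zero, Matrix.zero_mul, zero_add, add_zero,
          Matrix.one_mul, ← neg_sub, h3, Matrix.mul_neg, Matrix.mul_one, neg_add_eq_sub]

/-- `(CZ+D)ᴴ(AZ+B) − (AZ+B)ᴴ(CZ+D) = Z − Zᴴ` for `P ∈ U(J)`. [cite: Shimura1997, §6.2] -/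
theorem conjTranspose_denom_mul_num_sub {P : Matrix (l ⊕ l) (l ⊕ l) ℂ}
    (hP : Pᴴ * Matrix.J l ℂ * P = Matrix.J l ℂ) (Z : Matrix l l ℂ) :
    (denom P Z)ᴴ * num P Z - (num P Z)ᴴ * denom P Z = Z - Zᴴ := by
  rw [← key_identity hP Zᴴ Z, denom_def, num_def, conjTranspose_add, conjTranspose_add,
    conjTranspose_mul, conjTranspose_mul]

/-- `(CZ+D)ᴴ (g·Z − (g·Z)ᴴ) (CZ+D) = Z − Zᴴ` when `CZ + D` is invertible. [cite: Shimura1997, §6.2] -/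
theorem conjTranspose_denom_mul_sub_mul_denom {P : Matrix (l ⊕ l) (l ⊕ l) ℂ}
    (hP : Pᴴ * Matrix.J l ℂ * P = Matrix.J l ℂ) {Z : Matrix l l ℂ} (h : IsUnit (denom P Z).det) :
    (denom P Z)ᴴ * (moeb P Z - (moeb P Z)ᴴ) * denom P Z = Z - Zᴴ := by
  have h36 := conjTranspose_denom_mul_num_sub hP Z
  rw [← moeb_mul_denom h, conjTranspose_mul] at h36
  rw [← h36]
  simp only [Matrix.mul_sub, Matrix.sub_mul, Matrix.mul_assoc]

omit [Fintype l] [DecidableEq l] in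
/-- `Z − Zᴴ = 2i · Im Z` with `Im Z := (2i)⁻¹(Z − Zᴴ)`. [cite: KudlaRapoport2013, §7 (p. 31)] -/
theorem sub_conjTranspose_eq_smul_im (Z : Matrix l l ℂ) :
    Z - Zᴴ = (2 * I) • ((2 * I)⁻¹ • (Z - Zᴴ)) := by
  rw [smul_smul, mul_inv_cancel₀ (mul_ne_zero two_ne_zero I_ne_zero), one_smul]

omit [Fintype l] [DecidableEq l] in
/-- `Im Z` is hermitian. [cite: KudlaRapoport2013, §7 (p. 31)] -/
theorem isHermitian_im (Z : Matrix l l ℂ) : ((2 * I)⁻¹ • (Z - Zᴴ)).IsHermitian := by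
  unfold Matrix.IsHermitian
  rw [conjTranspose_smul, conjTranspose_sub, conjTranspose_conjTranspose, star_def, map_inv₀, map_mul,
    map_ofNat, conj_I, ← neg_sub Z, smul_neg, ← neg_smul, mul_neg, neg_inv, neg_neg]

omit [Fintype l] [DecidableEq l] in
/-- `Z = Re Z + i · Im Z` with `Re Z := 2⁻¹(Z + Zᴴ)`, `Im Z := (2i)⁻¹(Z − Zᴴ)`. [cite: KudlaRapoport2013, §7 (p. 31)] -/
theorem re_add_I_smul_im (Z : Matrix l l ℂ) :
    (2 : ℂ)⁻¹ • (Z + Zᴴ) + I • ((2 * I)⁻¹ • (Z - Zᴴ)) = Z := by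
  rw [smul_smul, mul_inv, ← mul_assoc, mul_comm I 2⁻¹, mul_assoc, mul_inv_cancel₀ I_ne_zero, mul_one,
    ← smul_add, add_add_sub_cancel, ← two_smul ℂ Z, smul_smul, inv_mul_cancel₀ two_ne_zero, one_smul]

omit [Fintype l] [DecidableEq l] in
/-- `Re Z` is hermitian. [cite: KudlaRapoport2013, §7 (p. 31)] -/
theorem isHermitian_re (Z : Matrix l l ℂ) : ((2 : ℂ)⁻¹ • (Z + Zᴴ)).IsHermitian := by
  unfold Matrix.IsHermitian
  rw [conjTranspose_smul, conjTranspose_add, conjTranspose_conjTranspose, star_def, map_inv₀, map_ofNat,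
    add_comm]

/-! ## 3. On the tube: `CZ + D` invertible, `Im(g·Z) = (CZ+D)⁻ᴴ Im Z (CZ+D)⁻¹ ≻ 0` -/

/-- **`CZ + D` is invertible** for `P ∈ U(J)` and `Im Z ≻ 0`: if `(CZ+D)v = 0` then §2 gives `vᴴ(Z − Zᴴ)v = 0`, i.e.
`vᴴ (Im Z) v = 0`, so `v = 0`. [cite: Shimura1997, §6.3] -/
theorem isUnit_denom {P : Matrix (l ⊕ l) (l ⊕ l) ℂ} (hP : Pᴴ * Matrix.J l ℂ * P = Matrix.J l ℂ)
    {Z : Matrix l l ℂ} (hZ : ((2 * I)⁻¹ • (Z - Zᴴ)).PosDef) : IsUnit (denom P Z) := by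
  rw [← mulVec_injective_iff_isUnit]
  suffices hker : ∀ v, denom P Z *ᵥ v = 0 → v = 0 by
    intro v w hvw
    exact sub_eq_zero.1 (hker (v - w) (by rw [mulVec_sub, hvw, sub_self]))
  intro v hv
  by_contra hne
  have h36 := congrArg (fun A ↦ star v ⬝ᵥ A *ᵥ v) (conjTranspose_denom_mul_num_sub hP Z)
  have hl : star v ⬝ᵥ ((denom P Z)ᴴ * num P Z - (num P Z)ᴴ * denom P Z) *ᵥ v = 0 := by
    rw [sub_mulVec, dotProduct_sub, ← mulVec_mulVec, ← mulVec_mulVec, hv, mulVec_zero,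
      dotProduct_zero, sub_zero, dotProduct_mulVec, ← star_mulVec, hv, star_zero, zero_dotProduct]
  rw [hl, sub_conjTranspose_eq_smul_im Z, smul_mulVec, dotProduct_smul, smul_eq_mul, eq_comm,
    mul_eq_zero] at h36
  rcases h36 with h2 | hq
  · exact (mul_ne_zero two_ne_zero I_ne_zero) h2
  · exact (hZ.dotProduct_mulVec_pos hne).ne' hq

/-- `det (CZ + D) ≠ 0` on the tube (determinant form). [cite: Shimura1997, §6.3] -/
theorem isUnit_det_denom {P : Matrix (l ⊕ l) (l ⊕ l) ℂ} (hP : Pᴴ * Matrix.J l ℂ * P = Matrix.J l ℂ)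
    {Z : Matrix l l ℂ} (hZ : ((2 * I)⁻¹ • (Z - Zᴴ)).PosDef) : IsUnit (denom P Z).det :=
  (isUnit_iff_isUnit_det _).1 (isUnit_denom hP hZ)

/-- **`(CZ+D)ᴴ · Im(g·Z) · (CZ+D) = Im Z`** on the tube. [cite: Shimura1997, §6.3] -/
theorem conjTranspose_denom_mul_im_moeb_mul_denom {P : Matrix (l ⊕ l) (l ⊕ l) ℂ}
    (hP : Pᴴ * Matrix.J l ℂ * P = Matrix.J l ℂ) {Z : Matrix l l ℂ} (hZ : ((2 * I)⁻¹ • (Z - Zᴴ)).PosDef) :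
    (denom P Z)ᴴ * ((2 * I)⁻¹ • (moeb P Z - (moeb P Z)ᴴ)) * denom P Z = (2 * I)⁻¹ • (Z - Zᴴ) := by
  rw [Matrix.mul_smul, Matrix.smul_mul, conjTranspose_denom_mul_sub_mul_denom hP (isUnit_det_denom hP hZ)]

/-- **`Im(g·Z) ≻ 0`**: `U(J)` preserves positivity of `Im`. [cite: Shimura1997, §6.3] -/
theorem posDef_im_moeb {P : Matrix (l ⊕ l) (l ⊕ l) ℂ} (hP : Pᴴ * Matrix.J l ℂ * P = Matrix.J l ℂ)
    {Z : Matrix l l ℂ} (hZ : ((2 * I)⁻¹ • (Z - Zᴴ)).PosDef) :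
    ((2 * I)⁻¹ • (moeb P Z - (moeb P Z)ᴴ)).PosDef := by
  have hden : IsUnit (denom P Z) := isUnit_denom hP hZ
  have h := hZ
  rw [← conjTranspose_denom_mul_im_moeb_mul_denom hP hZ, ← star_eq_conjTranspose] at h
  exact (Matrix.IsUnit.posDef_star_left_conjugate_iff hden).1 h

/-- **`g·Z ∈ ℌ_n` for `g ∈ U(J)`, `Z ∈ ℌ_n`** (the tree's `hermUpperHalfSpace`). [cite: KudlaRapoport2013, §7 (p. 31)] -/
theorem moeb_mem_hermUpperHalfSpace {n : ℕ} {P : Matrix (Fin n ⊕ Fin n) (Fin n ⊕ Fin n) ℂ}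
    (hP : Pᴴ * Matrix.J (Fin n) ℂ * P = Matrix.J (Fin n) ℂ) {Z : Matrix (Fin n) (Fin n) ℂ}
    (hZ : Z ∈ hermUpperHalfSpace n) : moeb P Z ∈ hermUpperHalfSpace n :=
  posDef_im_moeb hP hZ

/-- Membership in `hermUpperHalfSpace n` unfolded. [cite: KudlaRapoport2013, §7 (p. 31)] -/
theorem mem_hermUpperHalfSpace_iff {n : ℕ} {Z : Matrix (Fin n) (Fin n) ℂ} :
    Z ∈ hermUpperHalfSpace n ↔ ((2 * I)⁻¹ • (Z - Zᴴ)).PosDef :=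
  Iff.rfl

/-! ## 4. The cocycle and the action law on the tube -/

/-- **Cocycle of the automorphy factor**: `det(denom (gh) Z) = det(denom g (h·Z)) · det(denom h Z)` whenever `denom h Z` is
invertible. [cite: Shimura1997, §6.3] -/
theorem det_denom_mul {P Q : Matrix (l ⊕ l) (l ⊕ l) ℂ} {Z : Matrix l l ℂ} (hQ : IsUnit (denom Q Z).det) :
    (denom (P * Q) Z).det = (denom P (moeb Q Z)).det * (denom Q Z).det := by
  rw [denom_mul_eq hQ, det_mul]

/-- The cocycle for integral weights: `det(denom (gh) Z)^k = det(denom g (h·Z))^k · det(denom h Z)^k` (`k : ℤ`).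
[cite: Shimura1997, §6.3] -/
theorem det_denom_mul_zpow {P Q : Matrix (l ⊕ l) (l ⊕ l) ℂ} {Z : Matrix l l ℂ} (hQ : IsUnit (denom Q Z).det)
    (k : ℤ) : (denom (P * Q) Z).det ^ k = (denom P (moeb Q Z)).det ^ k * (denom Q Z).det ^ k := by
  rw [det_denom_mul hQ, mul_zpow]

/-- The cocycle on the tube (no invertibility hypothesis: `h ∈ U(J)`, `Im Z ≻ 0`). [cite: Shimura1997, §6.3] -/
theorem det_denom_mul_of_posDef {P Q : Matrix (l ⊕ l) (l ⊕ l) ℂ} (hQ : Qᴴ * Matrix.J l ℂ * Q = Matrix.J l ℂ)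
    {Z : Matrix l l ℂ} (hZ : ((2 * I)⁻¹ • (Z - Zᴴ)).PosDef) :
    (denom (P * Q) Z).det = (denom P (moeb Q Z)).det * (denom Q Z).det :=
  det_denom_mul (isUnit_det_denom hQ hZ)

/-- **Action law on the tube**: `(gh)·Z = g·(h·Z)` for `h ∈ U(J)`, `Im Z ≻ 0`. [cite: Shimura1997, §6.3] -/
theorem moeb_mul_of_posDef {P Q : Matrix (l ⊕ l) (l ⊕ l) ℂ} (hQ : Qᴴ * Matrix.J l ℂ * Q = Matrix.J l ℂ)
    {Z : Matrix l l ℂ} (hZ : ((2 * I)⁻¹ • (Z - Zᴴ)).PosDef) : moeb (P * Q) Z = moeb P (moeb Q Z) :=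
  moeb_mul (isUnit_det_denom hQ hZ)

/-- `det(denom g Z) ≠ 0` on the tube. [cite: Shimura1997, §6.3] -/
theorem det_denom_ne_zero {P : Matrix (l ⊕ l) (l ⊕ l) ℂ} (hP : Pᴴ * Matrix.J l ℂ * P = Matrix.J l ℂ)
    {Z : Matrix l l ℂ} (hZ : ((2 * I)⁻¹ • (Z - Zᴴ)).PosDef) : (denom P Z).det ≠ 0 :=
  (isUnit_det_denom hP hZ).ne_zero

/-! ## 5. The Siegel parabolic, translations, Levi elements, the inversion, the base point -/

omit [DecidableEq l] in
/-- For `C = 0`: `denom g Z = D` (constant in `Z`). [cite: Shimura1997, §6.4] -/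
theorem denom_of_toBlocks₂₁_eq_zero {P : Matrix (l ⊕ l) (l ⊕ l) ℂ} (hC : P.toBlocks₂₁ = 0) (Z : Matrix l l ℂ) :
    denom P Z = P.toBlocks₂₂ := by
  rw [denom_def, hC, Matrix.zero_mul, zero_add]

/-- For `C = 0`: `g·Z = (AZ + B) D⁻¹` (affine in `Z`). [cite: Shimura1997, §6.4] -/
theorem moeb_of_toBlocks₂₁_eq_zero {P : Matrix (l ⊕ l) (l ⊕ l) ℂ} (hC : P.toBlocks₂₁ = 0) (Z : Matrix l l ℂ) :
    moeb P Z = (P.toBlocks₁₁ * Z + P.toBlocks₁₂) * (P.toBlocks₂₂)⁻¹ := by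
  rw [moeb_def, denom_of_toBlocks₂₁_eq_zero hC, num_def]

/-- **Translations act by `Z ↦ Z + b`**: `u(b)·Z = Z + b`, `u(b) = (1 b; 0 1)`. [cite: Shimura1997, §6.4] -/
theorem moeb_transl (b Z : Matrix l l ℂ) : moeb (fromBlocks 1 b 0 1) Z = Z + b := by
  rw [moeb_def, num_fromBlocks, denom_fromBlocks, Matrix.one_mul, Matrix.zero_mul, zero_add, inv_one,
    Matrix.mul_one]

/-- The automorphy matrix of a translation is `1`. [cite: Shimura1997, §6.4] -/
theorem denom_transl (b Z : Matrix l l ℂ) : denom (fromBlocks 1 b 0 1) Z = 1 := by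
  rw [denom_fromBlocks, Matrix.zero_mul, zero_add]

/-- `u(b) ∈ U(J)` iff `b` is hermitian. [cite: Shimura1997, §5.1] -/
theorem transl_mem_iff (b : Matrix l l ℂ) :
    (fromBlocks 1 b 0 1 : Matrix (l ⊕ l) (l ⊕ l) ℂ)ᴴ * Matrix.J l ℂ * fromBlocks 1 b 0 1 = Matrix.J l ℂ ↔
      bᴴ = b := by
  rw [fromBlocks_conjTranspose_mul_J_mul_eq_iff]
  simp only [conjTranspose_one, conjTranspose_zero, Matrix.one_mul, Matrix.mul_one, Matrix.mul_zero,
    Matrix.zero_mul, sub_zero, true_and, and_true]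

/-- `u(b) u(b') = u(b + b')`. [cite: Shimura1997, §6.4] -/
theorem transl_mul_transl (b b' : Matrix l l ℂ) :
    (fromBlocks 1 b 0 1 : Matrix (l ⊕ l) (l ⊕ l) ℂ) * fromBlocks 1 b' 0 1 = fromBlocks 1 (b + b') 0 1 := by
  rw [fromBlocks_multiply]
  simp only [Matrix.one_mul, Matrix.mul_one, Matrix.mul_zero, Matrix.zero_mul, add_zero, zero_add, add_comm b']

/-- **Levi elements act by `Z ↦ a Z d⁻¹`**: `m·Z = a Z d⁻¹` for `m = (a 0; 0 d)`. [cite: Shimura1997, §6.4] -/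
theorem moeb_levi (a d Z : Matrix l l ℂ) : moeb (fromBlocks a 0 0 d) Z = a * Z * d⁻¹ := by
  rw [moeb_def, num_fromBlocks, denom_fromBlocks, Matrix.zero_mul, zero_add, add_zero]

omit [DecidableEq l] in
/-- The automorphy matrix of a Levi element is `d`. [cite: Shimura1997, §6.4] -/
theorem denom_levi (a d Z : Matrix l l ℂ) : denom (fromBlocks a 0 0 d) Z = d := by
  rw [denom_fromBlocks, Matrix.zero_mul, zero_add]

/-- `(a 0; 0 d) ∈ U(J)` iff `aᴴ d = 1` (so `d = a⁻ᴴ` and the action is `Z ↦ a Z aᴴ`). [cite: Shimura1997, §5.1] -/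
theorem levi_mem_iff (a d : Matrix l l ℂ) :
    (fromBlocks a 0 0 d : Matrix (l ⊕ l) (l ⊕ l) ℂ)ᴴ * Matrix.J l ℂ * fromBlocks a 0 0 d = Matrix.J l ℂ ↔
      aᴴ * d = 1 := by
  rw [fromBlocks_conjTranspose_mul_J_mul_eq_iff]
  simp only [conjTranspose_zero, Matrix.mul_zero, Matrix.zero_mul, sub_zero, true_and]
  constructor
  · exact fun h => h.1
  · intro h
    refine ⟨h, ?_⟩
    have := congrArg conjTranspose h
    rwa [conjTranspose_mul, conjTranspose_conjTranspose, conjTranspose_one] at this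

/-- For a Levi element of `U(J)` the action is `Z ↦ a Z aᴴ`. [cite: Shimura1997, §6.4] -/
theorem moeb_levi_of_mem {a d : Matrix l l ℂ} (h : aᴴ * d = 1) (Z : Matrix l l ℂ) :
    moeb (fromBlocks a 0 0 d) Z = a * Z * aᴴ := by
  rw [moeb_levi, inv_eq_left_inv h]

/-- **The inversion `J = (0 −1; 1 0)` acts by `Z ↦ −Z⁻¹`** with automorphy matrix `Z`. [cite: Shimura1997, §6.4] -/
theorem moeb_J (Z : Matrix l l ℂ) : moeb (Matrix.J l ℂ) Z = -Z⁻¹ := by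
  rw [Matrix.J, moeb_def, num_fromBlocks, denom_fromBlocks, Matrix.zero_mul, zero_add, Matrix.one_mul,
    add_zero, Matrix.neg_mul, Matrix.one_mul]

/-- `denom J Z = Z`. [cite: Shimura1997, §6.4] -/
theorem denom_J (Z : Matrix l l ℂ) : denom (Matrix.J l ℂ) Z = Z := by
  rw [Matrix.J, denom_fromBlocks, Matrix.one_mul, add_zero]

/-- `J ∈ U(J)`. [cite: Shimura1997, §5.1] -/
theorem J_mem : (Matrix.J l ℂ)ᴴ * Matrix.J l ℂ * Matrix.J l ℂ = Matrix.J l ℂ := by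
  have hJ : Matrix.J l ℂ = fromBlocks 0 (-1) 1 0 := rfl
  nth_rw 3 [hJ]; nth_rw 1 [hJ]
  rw [fromBlocks_conjTranspose_mul_J_mul_eq_iff]
  simp only [conjTranspose_zero, conjTranspose_one, conjTranspose_neg, Matrix.zero_mul, Matrix.mul_zero,
    Matrix.one_mul, Matrix.mul_one, sub_neg_eq_add, zero_add, and_self]

omit [Fintype l] in
/-- **The base point `i·1 ∈ ℌ`**: `Im(i·1) = 1 ≻ 0`. [cite: KudlaRapoport2013, §7 (p. 31)] -/
theorem im_I_smul_one : (2 * I)⁻¹ • (I • (1 : Matrix l l ℂ) - (I • (1 : Matrix l l ℂ))ᴴ) = 1 := by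
  rw [conjTranspose_smul, conjTranspose_one, star_def, conj_I, neg_smul, sub_neg_eq_add, ← two_smul ℂ,
    smul_smul, smul_smul, mul_assoc, inv_mul_cancel₀ (mul_ne_zero two_ne_zero I_ne_zero), one_smul]

omit [Fintype l] in
/-- `i·1 ∈ ℌ` (positivity form). [cite: KudlaRapoport2013, §7 (p. 31)] -/
theorem posDef_im_I_smul_one : ((2 * I)⁻¹ • (I • (1 : Matrix l l ℂ) - (I • (1 : Matrix l l ℂ))ᴴ)).PosDef := by
  rw [im_I_smul_one]
  exact PosDef.one

/-- `i·1 ∈ hermUpperHalfSpace n`. [cite: KudlaRapoport2013, §7 (p. 31)] -/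
theorem I_smul_one_mem_hermUpperHalfSpace (n : ℕ) : I • (1 : Matrix (Fin n) (Fin n) ℂ) ∈ hermUpperHalfSpace n :=
  posDef_im_I_smul_one

/-- **`u(X) m(R)·(i1) = X + i R²`** for `R` with `Rᴴ R⁻¹ = 1`-compatible data: precisely, for invertible `R`,
`moeb (u(X) · (R 0; 0 R⁻¹)) (i·1) = X + i·R²`. [cite: Shimura1997, §6.4] -/
theorem moeb_transl_mul_levi_I {X R : Matrix l l ℂ} (hR : IsUnit R.det) :
    moeb (fromBlocks 1 X 0 1 * fromBlocks R 0 0 R⁻¹) (I • (1 : Matrix l l ℂ)) = X + I • (R * R) := by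
  have hd : IsUnit (denom (fromBlocks R 0 0 R⁻¹) (I • (1 : Matrix l l ℂ))).det := by
    rw [denom_levi, det_nonsing_inv]
    exact hR.ringInverse
  rw [moeb_mul hd, moeb_levi, nonsing_inv_nonsing_inv R hR, moeb_transl, Matrix.mul_smul, Matrix.mul_one,
    Matrix.smul_mul, add_comm]

end Summit.HodgeConjecture.HodgeConjecture.Cruxes.HLiu418.K2LiuHermitianTubeCocycle
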